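import Literature.Barriers.CriticalPhenomena.GridSAWTiledDrawingOn
import HarnessLib

/-!
# Tiled grid drawings: validity of a selection of the placed edges

`GridSAWTiledDrawingOn.lean` proves that ALL edges placed by a tiling form a valid drawing under
global simplicity and a degree bound (`assembleOn_isValidW`). For the drawing of
`GridFormula.graphOf ψ` (`GridSAW.LOT2003_lemma4_gadgets`, Liśkiewicz–Ogihara–Toda 2003, Lemma 4 /
Theorem 7) it is more convenient to draw the EDGE LIST OF THE GRAPH itself, looking each edge up
among the placed tile edges (possibly reversed): adjacency with the graph is then by construction,
and simplicity / degrees are properties of the graph's edge list. This file proves the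
corresponding validity statement:

* `TilingHypsGeo` — the geometric hypotheses of a tiling (those of `TilingHypsOnW` without the
  global degree and simplicity fields), `TilingHypsOnW.geo`, `TilingHypsGeo.onW`;
* `IsPlacedOrRev`, `SubEdgesOK L verts E` — every chosen edge is a placed edge or the reversal of
  one, no two chosen edges have the same ends, every listed vertex is on at most three chosen edges;
* **`assembleSub_isValid`** — then the drawing `⟨verts, gpos, E⟩` is valid.

## References

* M. Liśkiewicz, M. Ogihara, S. Toda, TCS 304 (2003) 129–156, §4 (proof of Theorem 7, `E₀`).
-/

namespace Literature.Barriers.CriticalPhenomena.GridSAW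

/-- Grid adjacency is symmetric. [folklore] -/
theorem isGridEdge_symm {p q : GridPoint} (h : IsGridEdge p q) : IsGridEdge q p := by
  unfold IsGridEdge at *
  omega

/-- Reversing a grid path gives a grid path. [folklore] -/
theorem isChain_isGridEdge_reverse {l : List GridPoint} (h : List.IsChain IsGridEdge l) :
    List.IsChain IsGridEdge l.reverse := by
  rw [List.isChain_reverse]
  exact h.imp fun a b hab => isGridEdge_symm hab

/-- In a weakly valid tile, a common point of two DISTINCT edges is a vertex position. [folklore] -/
theorem Tile.ValidW.mem_pos_of_common {T : Tile} (hT : T.ValidW) {e e' : ℕ × ℕ × List GridPoint}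
    (he : e ∈ T.edges) (he' : e' ∈ T.edges) (hne : e ≠ e') {p : GridPoint} (hp : p ∈ e.2.2) (hp' : p ∈ e'.2.2) :
    p ∈ T.pos := by
  obtain ⟨m, hm, rfl⟩ := List.getElem_of_mem he
  obtain ⟨n, hn, rfl⟩ := List.getElem_of_mem he'
  have hmn : m ≠ n := fun h => hne (by subst h; rfl)
  have hpw := List.pairwise_iff_getElem.1 hT.pairwise_common
  rcases Nat.lt_or_gt_of_ne hmn with h | h
  · exact hpw m n hm hn h p hp hp'
  · exact hpw n m hn hm h p hp' hp

section Sub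

variable {L : List Placement} {verts : List ℕ} {gpos : ℕ → GridPoint}

/-- **The geometric hypotheses on a tiling by weakly valid tiles** (`TilingHypsOnW` without the
global degree and simplicity fields). [folklore] -/
structure TilingHypsGeo (L : List Placement) (verts : List ℕ) (gpos : ℕ → GridPoint) : Prop where
  /-- no placement listed twice -/
  nodup : L.Nodup
  /-- no name listed twice -/
  nodup_verts : verts.Nodup
  /-- every tile is weakly valid -/
  valid : ∀ P ∈ L, P.T.ValidW
  /-- local vertices are listed global vertices at the translated positions -/
  pos_eq : ∀ P ∈ L, ∀ i (hi : i < P.T.nv), P.ν i ∈ verts ∧ gpos (P.ν i) = P.shift P.T.pos[i]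
  /-- distinct tiles meet only along their boundaries, and there one of the two is restricted -/
  boxes : ∀ P ∈ L, ∀ Q ∈ L, P ≠ Q → ∀ q, P.Box q → Q.Box q → (P.Bdry q ∧ Q.Bdry q) ∧ (P.RestrG q ∨ Q.RestrG q)
  /-- a vertex of a tile lying in another tile's box is a vertex of that tile too -/
  crosslist : ∀ P ∈ L, ∀ Q ∈ L, ∀ j (hj : j < Q.T.nv), P.Box (Q.shift Q.T.pos[j]) →
    ∃ i, ∃ hi : i < P.T.nv, P.shift P.T.pos[i] = Q.shift Q.T.pos[j]
  /-- coinciding positions are the same global vertex -/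
  shared : ∀ P ∈ L, ∀ Q ∈ L, ∀ i (hi : i < P.T.nv), ∀ j (hj : j < Q.T.nv),
    P.shift P.T.pos[i] = Q.shift Q.T.pos[j] → P.ν i = Q.ν j
  /-- every listed vertex is placed -/
  cover : ∀ v ∈ verts, ∃ P ∈ L, ∃ i, i < P.T.nv ∧ P.ν i = v

/-- The hypotheses of `assembleOn_isValidW` contain the geometric ones. [folklore] -/
theorem TilingHypsOnW.geo (H : TilingHypsOnW L verts gpos) : TilingHypsGeo L verts gpos :=
  ⟨H.nodup, H.nodup_verts, H.valid, H.pos_eq, H.boxes, H.crosslist, H.shared, H.cover⟩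

/-- The geometric hypotheses with the two global fields give `TilingHypsOnW`. [folklore] -/
theorem TilingHypsGeo.onW (H : TilingHypsGeo L verts gpos) (hdeg : ∀ v ∈ verts, (assembleOn L verts gpos).degree v ≤ 3)
    (hsimple : (assembleOn L verts gpos).edges.Pairwise fun e e' => ¬ SDrawing.SameEndsS e e') :
    TilingHypsOnW L verts gpos :=
  ⟨H.nodup, H.nodup_verts, H.valid, H.pos_eq, H.boxes, H.crosslist, H.shared, H.cover, hdeg, hsimple⟩

/-- **A placed edge, possibly reversed.** [folklore] -/
def IsPlacedOrRev (L : List Placement) (d : SEdge ℕ) : Prop :=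
  ∃ P ∈ L, ∃ e ∈ P.T.edges, d = (P.ν e.1, P.ν e.2.1, e.2.2.map P.shift) ∨ d = (P.ν e.2.1, P.ν e.1, (e.2.2.map P.shift).reverse)

/-- **An admissible selection of edges**: placed-or-reversed edges, pairwise distinct ends, degrees
at most three. [folklore] -/
structure SubEdgesOK (L : List Placement) (verts : List ℕ) (E : List (SEdge ℕ)) : Prop where
  /-- every chosen edge is a placed edge or its reversal -/
  mem : ∀ d ∈ E, IsPlacedOrRev L d
  /-- no two chosen edges with the same ends -/
  simple : E.Pairwise fun e e' => ¬ SDrawing.SameEndsS e e'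
  /-- degrees -/
  degree : ∀ v ∈ verts, E.countP (fun e => decide (e.1 = v ∨ e.2.1 = v)) ≤ 3

/-- The data of a placed-or-reversed edge: the tile edge, its point set, and the two orientations.
[folklore] -/
theorem IsPlacedOrRev.exists {d : SEdge ℕ} (h : IsPlacedOrRev L d) :
    ∃ P ∈ L, ∃ e ∈ P.T.edges, (∀ p, p ∈ d.2.2 ↔ p ∈ e.2.2.map P.shift) ∧
      ((d.1 = P.ν e.1 ∧ d.2.1 = P.ν e.2.1 ∧ d.2.2 = e.2.2.map P.shift) ∨
        (d.1 = P.ν e.2.1 ∧ d.2.1 = P.ν e.1 ∧ d.2.2 = (e.2.2.map P.shift).reverse)) := by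
  obtain ⟨P, hP, e, he, rfl | rfl⟩ := h
  · exact ⟨P, hP, e, he, fun p => Iff.rfl, Or.inl ⟨rfl, rfl, rfl⟩⟩
  · exact ⟨P, hP, e, he, fun p => List.mem_reverse, Or.inr ⟨rfl, rfl, rfl⟩⟩

/-- **The drawing on an admissible selection of the placed edges is valid.**
[cite: LiskiewiczOgiharaToda2003, §4 (proof of Theorem 7, E₀)] -/
theorem assembleSub_isValid (H : TilingHypsGeo L verts gpos) {E : List (SEdge ℕ)} (hE : SubEdgesOK L verts E) :
    (⟨verts, gpos, E⟩ : SDrawing ℕ).IsValid := by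
  have ν_inj : ∀ {P : Placement}, P ∈ L → ∀ {i j : ℕ}, i < P.T.nv → j < P.T.nv → P.ν i = P.ν j → i = j := by
    intro P hP i j hi hj h
    have h1 := (H.pos_eq P hP i hi).2
    have h2 := (H.pos_eq P hP j hj).2
    rw [h] at h1
    exact (List.Nodup.getElem_inj_iff (H.valid P hP).2.1).1 (P.shift_injective (h1.symm.trans h2))
  have geoW : ∀ {P : Placement}, P ∈ L → ∀ {e : ℕ × ℕ × List GridPoint}, e ∈ P.T.edges → ∀ {p : GridPoint}, p ∈ e.2.2 →
      ∀ {Q : Placement}, Q ∈ L → ∀ {j : ℕ} (hj : j < Q.T.nv), P.shift p = Q.shift Q.T.pos[j] → p ∈ P.T.pos := by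
    intro P hP e he p hp Q hQ j hj heq
    obtain ⟨hbox, -, -, -⟩ := ((H.valid P hP).edge he).2.2.2.2.2.2.2 p hp
    have hq1 : P.Box (Q.shift Q.T.pos[j]) := by rw [← heq]; exact P.box_shift.2 hbox
    obtain ⟨i, hi, hieq⟩ := H.crosslist P hP Q hQ j hj hq1
    rw [← heq] at hieq
    rw [← P.shift_injective hieq]
    exact List.getElem_mem hi
  have commonW : ∀ {P Q : Placement}, P ∈ L → Q ∈ L → P ≠ Q → ∀ {e e' : ℕ × ℕ × List GridPoint}, e ∈ P.T.edges → e' ∈ Q.T.edges →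
      ∀ {p p' : GridPoint}, p ∈ e.2.2 → p' ∈ e'.2.2 → P.shift p = Q.shift p' → p ∈ P.T.pos := by
    intro P Q hP hQ hPQ e e' he he' p p' hp hp' heq
    obtain ⟨hbox, -, -, hbd⟩ := ((H.valid P hP).edge he).2.2.2.2.2.2.2 p hp
    obtain ⟨hbox', -, -, hbd'⟩ := ((H.valid Q hQ).edge he').2.2.2.2.2.2.2 p' hp'
    have hq1 : P.Box (P.shift p) := P.box_shift.2 hbox
    have hq2 : Q.Box (P.shift p) := by rw [heq]; exact Q.box_shift.2 hbox'
    rcases (H.boxes P hP Q hQ hPQ _ hq1 hq2).2 with hr | hr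
    · exact hbd (P.restrG_shift.1 hr)
    · have hp'pos : p' ∈ Q.T.pos := hbd' (Q.restrG_shift.1 (by rwa [heq] at hr))
      obtain ⟨j, hj, rfl⟩ := Tile.exists_getElem_of_mem hp'pos
      obtain ⟨i, hi, hieq⟩ := H.crosslist P hP Q hQ j hj (by rw [← heq]; exact hq1)
      rw [← heq] at hieq
      rw [← P.shift_injective hieq]
      exact List.getElem_mem hi
  have vertex_of_pos : ∀ {P : Placement}, P ∈ L → ∀ {p : GridPoint}, p ∈ P.T.pos → ∃ v ∈ verts, gpos v = P.shift p := by
    intro P hP p hp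
    obtain ⟨i, hi, rfl⟩ := Tile.exists_getElem_of_mem hp
    exact ⟨P.ν i, (H.pos_eq P hP i hi).1, (H.pos_eq P hP i hi).2⟩
  -- a common point of the underlying tile edges of two distinct chosen edges is a vertex position
  have common : ∀ {P Q : Placement}, P ∈ L → Q ∈ L → ∀ {e e' : ℕ × ℕ × List GridPoint}, e ∈ P.T.edges → e' ∈ Q.T.edges →
      ¬ (P = Q ∧ e = e') → ∀ {q : GridPoint}, q ∈ e.2.2.map P.shift → q ∈ e'.2.2.map Q.shift → ∃ v ∈ verts, gpos v = q := by
    intro P Q hP hQ e e' he he' hne q hq hq'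
    obtain ⟨p, hp, rfl⟩ := List.mem_map.1 hq
    obtain ⟨p', hp', heq⟩ := List.mem_map.1 hq'
    by_cases hPQ : P = Q
    · subst hPQ
      have hee : e ≠ e' := fun h => hne ⟨rfl, h⟩
      rw [P.shift_injective heq] at hp'
      exact vertex_of_pos hP ((H.valid P hP).mem_pos_of_common he he' hee hp hp')
    · exact vertex_of_pos hP (commonW hP hQ hPQ he he' hp hp' heq.symm)
  -- the ends of a chosen edge, as tile data
  have ends : ∀ {d}, d ∈ E → ∃ P ∈ L, ∃ e ∈ P.T.edges, (∀ p, p ∈ d.2.2 ↔ p ∈ e.2.2.map P.shift) ∧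
      ((d.1 = P.ν e.1 ∧ d.2.1 = P.ν e.2.1 ∧ d.2.2 = e.2.2.map P.shift) ∨
        (d.1 = P.ν e.2.1 ∧ d.2.1 = P.ν e.1 ∧ d.2.2 = (e.2.2.map P.shift).reverse)) := fun hd => (hE.mem _ hd).exists
  refine ⟨H.nodup_verts, ?_, ?_, ?_, ?_, ?_, ?_, ?_, ?_, ?_, hE.simple, ?_, fun v hv => hE.degree v hv⟩
  · -- distinct vertices at distinct points
    intro a ha b hb hab
    obtain ⟨P, hP, i, hi, rfl⟩ := H.cover a ha
    obtain ⟨Q, hQ, j, hj, rfl⟩ := H.cover b hb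
    change gpos (P.ν i) = gpos (Q.ν j) at hab
    rw [(H.pos_eq P hP i hi).2, (H.pos_eq Q hQ j hj).2] at hab
    exact H.shared P hP Q hQ i hi j hj hab
  · intro d hd
    obtain ⟨P, hP, e, he, -, ⟨h1, -, -⟩ | ⟨h1, -, -⟩⟩ := ends hd
    · rw [show d.1 = P.ν e.1 from h1]; exact (H.pos_eq P hP _ ((H.valid P hP).edge he).1).1
    · rw [show d.1 = P.ν e.2.1 from h1]; exact (H.pos_eq P hP _ ((H.valid P hP).edge he).2.1).1
  · intro d hd
    obtain ⟨P, hP, e, he, -, ⟨-, h2, -⟩ | ⟨-, h2, -⟩⟩ := ends hd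
    · rw [show d.2.1 = P.ν e.2.1 from h2]; exact (H.pos_eq P hP _ ((H.valid P hP).edge he).2.1).1
    · rw [show d.2.1 = P.ν e.1 from h2]; exact (H.pos_eq P hP _ ((H.valid P hP).edge he).1).1
  · -- no loops
    intro d hd
    obtain ⟨P, hP, e, he, -, ⟨h1, h2, -⟩ | ⟨h1, h2, -⟩⟩ := ends hd
    · have hv := (H.valid P hP).edge he
      change d.1 ≠ d.2.1
      rw [h1, h2]
      exact fun h => hv.2.2.1 (ν_inj hP hv.1 hv.2.1 h)
    · have hv := (H.valid P hP).edge he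
      change d.1 ≠ d.2.1
      rw [h1, h2]
      exact fun h => hv.2.2.1 (ν_inj hP hv.1 hv.2.1 h.symm)
  · -- the path starts at the first end
    intro d hd
    obtain ⟨P, hP, e, he, -, ⟨h1, -, h3⟩ | ⟨h1, -, h3⟩⟩ := ends hd
    · have hv := (H.valid P hP).edge he
      change d.2.2.head? = some (gpos d.1)
      rw [h3, h1, List.head?_map, hv.2.2.2.1, List.getElem?_eq_getElem hv.1, Option.map_some, (H.pos_eq P hP _ hv.1).2]
    · have hv := (H.valid P hP).edge he
      change d.2.2.head? = some (gpos d.1)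
      rw [h3, h1, List.head?_reverse, List.getLast?_map, hv.2.2.2.2.1, List.getElem?_eq_getElem hv.2.1, Option.map_some,
        (H.pos_eq P hP _ hv.2.1).2]
  · intro d hd
    obtain ⟨P, hP, e, he, -, ⟨-, h2, h3⟩ | ⟨-, h2, h3⟩⟩ := ends hd
    · have hv := (H.valid P hP).edge he
      change d.2.2.getLast? = some (gpos d.2.1)
      rw [h3, h2, List.getLast?_map, hv.2.2.2.2.1, List.getElem?_eq_getElem hv.2.1, Option.map_some, (H.pos_eq P hP _ hv.2.1).2]
    · have hv := (H.valid P hP).edge he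
      change d.2.2.getLast? = some (gpos d.2.1)
      rw [h3, h2, List.getLast?_reverse, List.head?_map, hv.2.2.2.1, List.getElem?_eq_getElem hv.1, Option.map_some,
        (H.pos_eq P hP _ hv.1).2]
  · -- self-avoiding
    intro d hd
    obtain ⟨P, hP, e, he, -, ⟨-, -, h3⟩ | ⟨-, -, h3⟩⟩ := ends hd
    · rw [h3]
      exact ((H.valid P hP).edge he).2.2.2.2.2.1.map P.shift_injective
    · rw [h3, List.nodup_reverse]
      exact ((H.valid P hP).edge he).2.2.2.2.2.1.map P.shift_injective
  · -- grid paths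
    intro d hd
    obtain ⟨P, hP, e, he, -, ⟨-, -, h3⟩ | ⟨-, -, h3⟩⟩ := ends hd
    · rw [h3, List.isChain_map]
      exact ((H.valid P hP).edge he).2.2.2.2.2.2.1.imp fun a b h => P.isGridEdge_shift.2 h
    · rw [h3]
      refine isChain_isGridEdge_reverse ?_
      rw [List.isChain_map]
      exact ((H.valid P hP).edge he).2.2.2.2.2.2.1.imp fun a b h => P.isGridEdge_shift.2 h
  · -- paths meet vertex positions only at their ends
    intro d hd v hv hmem
    obtain ⟨P, hP, e, he, hpts, hor⟩ := ends hd
    obtain ⟨Q, hQ, j, hj, rfl⟩ := H.cover v hv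
    change gpos (Q.ν j) ∈ d.2.2 at hmem
    rw [hpts, (H.pos_eq Q hQ j hj).2, List.mem_map] at hmem
    obtain ⟨p, hp, heq⟩ := hmem
    have hpos : p ∈ P.T.pos := geoW hP he hp hQ hj heq
    have hT := H.valid P hP
    change Q.ν j = d.1 ∨ Q.ν j = d.2.1
    rcases hT.eq_end_of_mem he hp hpos with h | h
    · have : Q.ν j = P.ν e.1 := (H.shared P hP Q hQ _ (hT.edge he).1 j hj (by rw [h, heq])).symm
      rcases hor with ⟨h1, -, -⟩ | ⟨-, h2, -⟩
      · exact Or.inl (this.trans h1.symm)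
      · exact Or.inr (this.trans h2.symm)
    · have : Q.ν j = P.ν e.2.1 := (H.shared P hP Q hQ _ (hT.edge he).2.1 j hj (by rw [h, heq])).symm
      rcases hor with ⟨-, h2, -⟩ | ⟨h1, -, -⟩
      · exact Or.inr (this.trans h2.symm)
      · exact Or.inl (this.trans h1.symm)
  · -- congestion-free
    refine hE.simple.imp_of_mem fun {d d'} hd hd' hne q hq hq' => ?_
    obtain ⟨P, hP, e, he, hpts, hor⟩ := ends hd
    obtain ⟨Q, hQ, e', he', hpts', hor'⟩ := ends hd'
    refine common hP hQ he he' (fun ⟨hPQ, hee⟩ => hne ?_) ((hpts q).1 hq) ((hpts' q).1 hq')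
    subst hPQ; subst hee
    unfold SDrawing.SameEndsS
    rcases hor with ⟨h1, h2, -⟩ | ⟨h1, h2, -⟩ <;> rcases hor' with ⟨h1', h2', -⟩ | ⟨h1', h2', -⟩
    · exact Or.inl ⟨h1.trans h1'.symm, h2.trans h2'.symm⟩
    · exact Or.inr ⟨h1.trans h2'.symm, h2.trans h1'.symm⟩
    · exact Or.inr ⟨h1.trans h2'.symm, h2.trans h1'.symm⟩
    · exact Or.inl ⟨h1.trans h1'.symm, h2.trans h2'.symm⟩

end Sub

end Literature.Barriers.CriticalPhenomena.GridSAW
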